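import Mathlib.Topology.Algebra.ClopenNhdofOne
import Mathlib.Topology.Algebra.OpenSubgroup
import Mathlib.Topology.Algebra.Group.ClosedSubgroup
import Mathlib.GroupTheory.FiniteAbelian.Basic
import Literature.GroupTheory.Nilpotent.CommutatorWidthGenerators
import HarnessLib

/-!
# Serre's lemma: in a topologically finitely generated pro-`p` group the abstract Frattini subgroup is open

J.-P. Serre, *Galois Cohomology*, I §4.2, exercise 6; J. D. Dixon, M. P. F. du Sautoy, A. Mann, D. Segal,
*Analytic pro-`p` groups* (2nd ed.), Prop. 1.16, Prop. 1.19, Thm. 1.17.  For a profinite group `G`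
(compact, totally disconnected topological group) which is PRO-`p` (every finite continuous quotient
`G/U`, `U` open normal, is a `p`-group) and TOPOLOGICALLY FINITELY GENERATED by `a₁, …, a_d` (the
abstract subgroup they generate is dense):

* `exists_eq_pow_mul_prod_commutator_of_mem_frattiniClosure` — every element of the CLOSED subgroup
  `Φ := closure of ⟨x^p, ⁅y, z⁆ : x y z ∈ G⟩` is a Frattini word of bounded shape
  `x^p · ⁅a₁, g₁⁆ ⋯ ⁅a_d, g_d⁆` (compactness: the set of such words is compact and maps onto the Frattini
  subgroup of every finite quotient `G/U`, by `CommutatorWidthGenerators.lean`);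
* `isOpen_frattiniClosure` — `Φ` is open (`G/Φ` is an elementary abelian `p`-group topologically
  generated by `d` elements, hence finite);
* `isOpen_of_forall_pow_mem_of_forall_commutator_mem` — **Serre's lemma**: every ABSTRACT subgroup of
  `G` containing all `p`-th powers and all commutators contains `Φ`, hence is open.  Equivalently
  every homomorphism from `G` onto an elementary abelian `p`-group is continuous.

Proof-only (no definitions); Mathlib + `CommutatorWidthGenerators.lean`.
[cite: DixonDuSautoyMannSegal1999, Ch. 1 Prop. 1.19, Thm. 1.17] [cite: SerreGaloisCohomology1997, I §4.2 ex. 6]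
-/

namespace Literature.GroupTheory.ProP

open Subgroup Topology
open scoped commutatorElement Pointwise

universe u v

section Continuity

/-- An ordered product `∏ᵢ Fᵢ(x)` over `Fin d` of continuous functions is continuous.
[cite: DixonDuSautoyMannSegal1999, Ch. 1 Prop. 1.19] -/
theorem continuous_prod_ofFn {X : Type u} {M : Type v} [TopologicalSpace X] [TopologicalSpace M]
    [Monoid M] [ContinuousMul M] {d : ℕ} (F : Fin d → X → M) (hF : ∀ i, Continuous (F i)) :
    Continuous fun x => (List.ofFn fun i => F i x).prod := by
  induction d with
  | zero => simp only [List.ofFn_zero, List.prod_nil]; exact continuous_const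
  | succ d ih =>
    simp only [List.ofFn_succ, List.prod_cons]
    exact (hF 0).mul (ih (fun i => F i.succ) (fun i => hF i.succ))

end Continuity

variable {G : Type u} [Group G] [TopologicalSpace G] [IsTopologicalGroup G] [CompactSpace G]
  [TotallyDisconnectedSpace G]

omit [CompactSpace G] [TotallyDisconnectedSpace G] in
/-- The image in a continuous quotient `G/U` (`U` open) of a topologically generating family generates
`G/U` abstractly. [cite: DixonDuSautoyMannSegal1999, Ch. 1 Prop. 1.16] -/
theorem closure_range_mk_comp_eq_top {d : ℕ} {a : Fin d → G}
    (ha : (Subgroup.closure (Set.range a)).topologicalClosure = ⊤)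
    (U : Subgroup G) [U.Normal] (hU : IsOpen (U : Set G)) :
    Subgroup.closure (Set.range (fun i => (QuotientGroup.mk (a i) : G ⧸ U))) = ⊤ := by
  rw [eq_top_iff]
  rintro q -
  obtain ⟨x, rfl⟩ := QuotientGroup.mk_surjective q
  have hdense : Dense ((Subgroup.closure (Set.range a) : Subgroup G) : Set G) := by
    rw [dense_iff_closure_eq, ← Subgroup.topologicalClosure_coe, ha, Subgroup.coe_top]
  -- the open coset `x • U` meets the dense subgroup
  have hopen : IsOpen ((fun y => x⁻¹ * y) ⁻¹' (U : Set G)) := hU.preimage (by fun_prop)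
  obtain ⟨k, hk, hkU⟩ := hdense.exists_mem_open hopen ⟨x, by simp [U.one_mem]⟩
  have hq : (QuotientGroup.mk x : G ⧸ U) = QuotientGroup.mk k := QuotientGroup.eq.mpr hkU
  have hrange : Set.range (fun i => (QuotientGroup.mk (a i) : G ⧸ U)) =
      (QuotientGroup.mk' U) '' Set.range a := by
    rw [← Set.range_comp]; rfl
  rw [hq, hrange, ← MonoidHom.map_closure]
  exact Subgroup.mem_map_of_mem _ hk

/-- **Bounded Frattini words exhaust the closed Frattini subgroup.** In a pro-`p` group topologically
generated by `a₁, …, a_d`, every element of the closure `Φ` of the subgroup generated by the `p`-th powers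
and the commutators is of the form `x^p · ⁅a₁, g₁⁆ ⋯ ⁅a_d, g_d⁆`.
[cite: DixonDuSautoyMannSegal1999, Ch. 1 Prop. 1.19] -/
theorem exists_eq_pow_mul_prod_commutator_of_mem_frattiniClosure {p : ℕ} [Fact p.Prime]
    (hP : ∀ U : OpenNormalSubgroup G, IsPGroup p (G ⧸ U.toSubgroup))
    {d : ℕ} {a : Fin d → G} (ha : (Subgroup.closure (Set.range a)).topologicalClosure = ⊤) {g : G}
    (hg : g ∈ (Subgroup.closure
      ({x : G | ∃ y : G, y ^ p = x} ∪ {x : G | ∃ y z : G, ⁅y, z⁆ = x})).topologicalClosure) :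
    ∃ (x : G) (f : Fin d → G), g = x ^ p * (List.ofFn fun i => ⁅a i, f i⁆).prod := by
  classical
  set S : Set G := {x : G | ∃ y : G, y ^ p = x} ∪ {x : G | ∃ y z : G, ⁅y, z⁆ = x} with hS
  -- the compact set `X` of bounded Frattini words
  let w : G × (Fin d → G) → G := fun xf => xf.1 ^ p * (List.ofFn fun i => ⁅a i, xf.2 i⁆).prod
  have hw : Continuous w := by
    refine Continuous.mul (continuous_fst.pow p) ?_
    refine continuous_prod_ofFn (fun i (xf : G × (Fin d → G)) => ⁅a i, xf.2 i⁆) (fun i => ?_)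
    simp only [commutatorElement_def]
    fun_prop
  have hX : IsClosed (Set.range w) := (isCompact_range hw).isClosed
  -- it suffices to show `g ∈ Set.range w`; argue by closedness through the open normal subgroups
  suffices hmem : g ∈ Set.range w by
    obtain ⟨⟨x, f⟩, rfl⟩ := hmem
    exact ⟨x, f, rfl⟩
  by_contra hnot
  -- an open normal `U` with `g • U` disjoint from `X`
  have hV : IsOpen ((fun u => g * u) ⁻¹' (Set.range w)ᶜ) := hX.isOpen_compl.preimage (by fun_prop)
  obtain ⟨U, hU⟩ := ProfiniteGrp.exist_openNormalSubgroup_sub_open_nhds_of_one hV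
    (by simpa only [Set.mem_preimage, mul_one, Set.mem_compl_iff] using hnot)
  -- in the finite `p`-group `G/U`, generated by the images of the `aᵢ`, `ḡ` is a Frattini word
  haveI : Finite (G ⧸ U.toSubgroup) := Subgroup.quotient_finite_of_isOpen U.toSubgroup U.isOpen
  have hgen := closure_range_mk_comp_eq_top ha U.toSubgroup U.isOpen
  -- `mk g` lies in the abstract subgroup of `G/U` generated by `p`-th powers and commutators
  have hgU : (QuotientGroup.mk g : G ⧸ U.toSubgroup) ∈ Subgroup.closure
      ({x : G ⧸ U.toSubgroup | ∃ y, y ^ p = x} ∪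
        {x : G ⧸ U.toSubgroup | ∃ y z : G ⧸ U.toSubgroup, ⁅y, z⁆ = x}) := by
    -- `g` is in the closure of `closure S`; the coset `g • U` is an open neighbourhood of `g`
    have hopen : IsOpen ((fun y => g⁻¹ * y) ⁻¹' (U : Set G)) := U.isOpen.preimage (by fun_prop)
    have hgc : g ∈ _root_.closure ((Subgroup.closure S : Subgroup G) : Set G) := by
      rw [← Subgroup.topologicalClosure_coe]; exact hg
    obtain ⟨h, hhU, hh⟩ := _root_.mem_closure_iff.mp hgc _ hopen (by simp)
    have hq : (QuotientGroup.mk g : G ⧸ U.toSubgroup) = QuotientGroup.mk h := QuotientGroup.eq.mpr hhU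
    rw [hq]
    have hmap : (Subgroup.closure S).map (QuotientGroup.mk' U.toSubgroup) ≤ Subgroup.closure
        ({x : G ⧸ U.toSubgroup | ∃ y, y ^ p = x} ∪
        {x : G ⧸ U.toSubgroup | ∃ y z : G ⧸ U.toSubgroup, ⁅y, z⁆ = x}) := by
      rw [MonoidHom.map_closure]
      apply Subgroup.closure_mono
      rintro _ ⟨y, hy, rfl⟩
      rcases hy with ⟨z, rfl⟩ | ⟨z, z', rfl⟩
      · exact Or.inl ⟨QuotientGroup.mk z, by rw [QuotientGroup.mk'_apply, QuotientGroup.mk_pow]⟩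
      · exact Or.inr ⟨QuotientGroup.mk z, QuotientGroup.mk z',
          by rw [QuotientGroup.mk'_apply, ← QuotientGroup.mk'_apply U.toSubgroup ⁅z, z'⁆,
            map_commutatorElement, QuotientGroup.mk'_apply, QuotientGroup.mk'_apply]⟩
    exact hmap (Subgroup.mem_map_of_mem _ hh)
  obtain ⟨xbar, fbar, hxf⟩ :=
    Literature.GroupTheory.Nilpotent.exists_eq_pow_mul_prod_commutator_of_isPGroup
      (fun i => (QuotientGroup.mk (a i) : G ⧸ U.toSubgroup)) (hP U) hgen hgU
  -- lift the word to `G`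
  obtain ⟨x, rfl⟩ := QuotientGroup.mk_surjective xbar
  choose f hf using fun i => QuotientGroup.mk_surjective (fbar i)
  have hword : (QuotientGroup.mk (w (x, f)) : G ⧸ U.toSubgroup) = QuotientGroup.mk g := by
    rw [hxf]
    show (QuotientGroup.mk' U.toSubgroup) (x ^ p * (List.ofFn fun i => ⁅a i, f i⁆).prod) = _
    rw [map_mul, map_pow, map_list_prod, List.map_ofFn]
    congr 2
    refine congrArg List.ofFn (funext fun i => ?_)
    simp only [Function.comp_apply, map_commutatorElement, QuotientGroup.mk'_apply, hf]
  -- contradiction: `w (x, f) ∈ g • U ⊆ Xᶜ`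
  have hmemU : g⁻¹ * w (x, f) ∈ (U : Set G) := QuotientGroup.eq.mp hword.symm
  have := hU hmemU
  simp only [Set.mem_preimage, mul_inv_cancel_left, Set.mem_compl_iff, Set.mem_range_self,
    not_true_eq_false] at this

omit [CompactSpace G] [TotallyDisconnectedSpace G] in
/-- The closed Frattini subgroup `Φ` has finite index: `G/Φ` is an abelian group of exponent `p`
topologically generated by `d` elements, hence finite. [cite: DixonDuSautoyMannSegal1999, Ch. 1 Prop. 1.16] -/
theorem finiteIndex_frattiniClosure {p : ℕ} [Fact p.Prime]
    {d : ℕ} {a : Fin d → G} (ha : (Subgroup.closure (Set.range a)).topologicalClosure = ⊤) :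
    ((Subgroup.closure
      ({x : G | ∃ y : G, y ^ p = x} ∪ {x : G | ∃ y z : G, ⁅y, z⁆ = x})).topologicalClosure).FiniteIndex := by
  classical
  set Φ := (Subgroup.closure
      ({x : G | ∃ y : G, y ^ p = x} ∪ {x : G | ∃ y z : G, ⁅y, z⁆ = x})).topologicalClosure with hΦ
  -- `Φ` is normal: it contains the commutator subgroup
  have hcomm : ∀ y z : G, ⁅y, z⁆ ∈ Φ := fun y z =>
    Subgroup.le_topologicalClosure _ (Subgroup.subset_closure (Or.inr ⟨y, z, rfl⟩))
  have hpow : ∀ y : G, y ^ p ∈ Φ := fun y =>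
    Subgroup.le_topologicalClosure _ (Subgroup.subset_closure (Or.inl ⟨y, rfl⟩))
  haveI hN : Φ.Normal := by
    refine ⟨fun n hn g => ?_⟩
    have : g * n * g⁻¹ = ⁅g, n⁆ * n := by simp only [commutatorElement_def]; group
    rw [this]
    exact mul_mem (hcomm g n) hn
  -- the quotient is commutative and of exponent `p`
  set Q := G ⧸ Φ
  haveI : IsMulCommutative Q := ⟨⟨fun x y => by
    obtain ⟨x, rfl⟩ := QuotientGroup.mk_surjective x
    obtain ⟨y, rfl⟩ := QuotientGroup.mk_surjective y
    rw [← QuotientGroup.mk_mul, ← QuotientGroup.mk_mul, QuotientGroup.eq]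
    have : (x * y)⁻¹ * (y * x) = ⁅y⁻¹, x⁻¹⁆ := by simp only [commutatorElement_def]; group
    rw [this]; exact hcomm _ _⟩⟩
  -- the abstract subgroup generated by the images of the `aᵢ` is finite …
  set A : Subgroup Q := Subgroup.closure (Set.range fun i => (QuotientGroup.mk (a i) : Q)) with hA
  haveI : Finite (Set.range fun i => (QuotientGroup.mk (a i) : Q)) := Set.finite_range _ |>.to_subtype
  have htors : Monoid.IsTorsion A := by
    intro q
    refine isOfFinOrder_iff_pow_eq_one.mpr ⟨p, (Fact.out : p.Prime).pos, ?_⟩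
    obtain ⟨q, hq⟩ := q
    obtain ⟨x, rfl⟩ := QuotientGroup.mk_surjective q
    apply Subtype.ext
    show (QuotientGroup.mk x : Q) ^ p = 1
    rw [← QuotientGroup.mk_pow, QuotientGroup.eq_one_iff]
    exact hpow x
  haveI : Finite A := by
    open scoped IsMulCommutative in
    exact CommGroup.finite_of_fg_torsion (G := A) htors
  -- … closed, and dense, hence everything
  haveI : T1Space Q := (QuotientGroup.t1Space_iff (N := Φ)).mpr (Subgroup.isClosed_topologicalClosure _)
  have hAclosed : IsClosed (A : Set Q) := (Set.toFinite (A : Set Q)).isClosed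
  have hAdense : Dense (A : Set Q) := by
    have hd : Dense ((Subgroup.closure (Set.range a) : Subgroup G) : Set G) := by
      rw [dense_iff_closure_eq, ← Subgroup.topologicalClosure_coe, ha, Subgroup.coe_top]
    have himg := (QuotientGroup.mk_surjective (s := Φ)).denseRange.dense_image
      (continuous_quotient_mk') hd
    have heq : (QuotientGroup.mk : G → Q) '' ((Subgroup.closure (Set.range a) : Subgroup G) : Set G) =
        (A : Set Q) := by
      rw [hA, show (QuotientGroup.mk : G → Q) = QuotientGroup.mk' Φ from rfl, ← Subgroup.coe_map,
        MonoidHom.map_closure, ← Set.range_comp]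
      rfl
    rwa [heq] at himg
  have hAtop : A = ⊤ := by
    rw [← SetLike.coe_set_eq, Subgroup.coe_top, ← hAdense.closure_eq, hAclosed.closure_eq]
  haveI : Finite Q := by
    have e : A ≃ Q := (MulEquiv.subgroupCongr hAtop).toEquiv.trans Subgroup.topEquiv.toEquiv
    exact Finite.of_equiv _ e
  exact Subgroup.finiteIndex_of_finite_quotient

omit [CompactSpace G] [TotallyDisconnectedSpace G] in
/-- The closed Frattini subgroup of a topologically finitely generated profinite group is open.
[cite: DixonDuSautoyMannSegal1999, Ch. 1 Prop. 1.16] -/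
theorem isOpen_frattiniClosure {p : ℕ} [Fact p.Prime]
    {d : ℕ} {a : Fin d → G} (ha : (Subgroup.closure (Set.range a)).topologicalClosure = ⊤) :
    IsOpen (((Subgroup.closure
      ({x : G | ∃ y : G, y ^ p = x} ∪ {x : G | ∃ y z : G, ⁅y, z⁆ = x})).topologicalClosure :
        Subgroup G) : Set G) := by
  haveI := finiteIndex_frattiniClosure (p := p) ha
  exact Subgroup.isOpen_of_isClosed_of_finiteIndex _ (Subgroup.isClosed_topologicalClosure _)

/-- **Serre's lemma.** In a topologically finitely generated pro-`p` group, every abstract subgroup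
containing all `p`-th powers and all commutators is open; in particular every (abstract) normal
subgroup of index `p` is open. [cite: SerreGaloisCohomology1997, I §4.2 ex. 6]
[cite: DixonDuSautoyMannSegal1999, Ch. 1 Thm. 1.17] -/
theorem isOpen_of_forall_pow_mem_of_forall_commutator_mem {p : ℕ} [Fact p.Prime]
    (hP : ∀ U : OpenNormalSubgroup G, IsPGroup p (G ⧸ U.toSubgroup))
    {d : ℕ} {a : Fin d → G} (ha : (Subgroup.closure (Set.range a)).topologicalClosure = ⊤)
    (H : Subgroup G) (hpow : ∀ x : G, x ^ p ∈ H) (hcomm : ∀ x y : G, ⁅x, y⁆ ∈ H) :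
    IsOpen (H : Set G) := by
  refine Subgroup.isOpen_mono ?_ (isOpen_frattiniClosure (p := p) ha)
  intro g hg
  obtain ⟨x, f, rfl⟩ := exists_eq_pow_mul_prod_commutator_of_mem_frattiniClosure hP ha hg
  refine mul_mem (hpow x) (list_prod_mem ?_)
  intro c hc
  rw [List.mem_ofFn] at hc
  obtain ⟨i, rfl⟩ := hc
  exact hcomm _ _

/-- **Serre's lemma, surjective form.** A homomorphism from a topologically finitely generated pro-`p`
group to a group in which every element has order dividing `p` and all commutators of images vanish —
e.g. onto `ℤ/p` — has open kernel, i.e. is continuous for the discrete topology on the target.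
[cite: SerreGaloisCohomology1997, I §4.2 ex. 6] -/
theorem isOpen_ker_of_pow_eq_one {p : ℕ} [Fact p.Prime]
    (hP : ∀ U : OpenNormalSubgroup G, IsPGroup p (G ⧸ U.toSubgroup))
    {d : ℕ} {a : Fin d → G} (ha : (Subgroup.closure (Set.range a)).topologicalClosure = ⊤)
    {M : Type v} [CommGroup M] (φ : G →* M) (hM : ∀ m : M, m ^ p = 1) :
    IsOpen (φ.ker : Set G) := by
  refine isOpen_of_forall_pow_mem_of_forall_commutator_mem hP ha φ.ker (fun x => ?_) (fun x y => ?_)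
  · rw [MonoidHom.mem_ker, map_pow, hM]
  · rw [MonoidHom.mem_ker, map_commutatorElement, commutatorElement_eq_one_iff_commute]
    exact Commute.all _ _

end Literature.GroupTheory.ProP
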